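import Mathlib.Analysis.SpecialFunctions.Trigonometric.Bounds
import Mathlib.Analysis.Real.Pi.Bounds
import Mathlib.Analysis.Complex.Norm

/-!
# `BalabanUV.Beta.GAN24.DirichletRingWirtinger` — binder row G-an2-4 / (CONV-C), road P2 PART IV, leaves L1–L2 of the ring lemma: THE SHARP
# DISCRETE WIRTINGER INEQUALITY ON A PATH WITH DIRICHLET ENDS, with the explicit constant `m²/π² + 1/6` (unit b2b-balaban-gan24-p2, gen 24, v1)

HONEST FRAMING (cell contract, verbatim): «discharging `BetaPertH` makes Bałaban's UV stability UNCONDITIONAL — a real constructive-QFT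
result; it is NOT the continuum limit and NOT the Clay problem.»  This file is a pure real/complex-analysis brick (no lattice objects) for the
one-level weighted regularity programme of memo `HOME/b2b-balaban-gan24-p2/gen24/W-FULL-WEIGHTED.md` §3 (the ring lemma at a 270° vertex,
leaves L1–L2): the square-ring energy recursion around a re-entrant vertex needs the Wirtinger inequality along the lattice path `∂Q_k ∩ Ω`
with a constant whose leading term is SHARP (`(m/π)²`, not `m²/8` or `m²/4`), because the resulting energy-decay exponent `π/3` must exceed `1`.

 * §1 `two_re_conj_mul_le` — the weighted arithmetic–geometric mean `2·Re(āb) ≤ (q/p)|a|² + (p/q)|b|²` (`p, q > 0`);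
   `sin_ground_pos`, `sin_succ_add_sin_pred` — the ground state `v_i = sin(πi/m)` is positive inside the path and satisfies the eigen-relation
   `v_{i+1} + v_{i−1} = 2cos(π/m)·v_i`.
 * §2 **`wirtinger_path`** — for `m ≥ 2` and `g : ℕ → ℂ` with `g 0 = g m = 0`:
   `(2 − 2cos(π/m))·Σ_{i<m}‖g i‖² ≤ Σ_{i<m}‖g(i+1) − g i‖²`   (ground-state substitution; the constant `2 − 2cos(π/m) = 4sin²(π/2m)` is the
   first Dirichlet eigenvalue of the path, attained at `g = v`).
 * §3 `two_sub_two_cos_eq`, `two_sub_two_cos_ge`, **`inv_two_sub_two_cos_le`**: `2 − 2cos(π/m) = 4sin²(π/2m) ≥ (π/m)² − (π/m)⁴/12`, hence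
   `(2 − 2cos(π/m))⁻¹ ≤ m²/π² + 1/6` (`m ≥ 2`), and the usable form **`wirtinger_path_explicit`**:
   `Σ_{i<m}‖g i‖² ≤ (m²/π² + 1/6)·Σ_{i<m}‖g(i+1) − g i‖²`.

ABSOLUTE RULE (cell, verbatim): «No internally-minted statement may enter as a cited fact. Every hypothesis is either kernel-proved in
this package or a verbatim quotation of a PUBLISHED theorem with page reference. The manuscript(s) under audit are NOT citable for
their own disputed steps — they are the thing under adjudication; programme-internal (2001/route/tribunal) claims are never citable.»
[folklore] elementary trigonometry and finite sums; nothing printed is a hypothesis.  NOT CLAIMED: the ring lemma itself (L3–L8), the weighted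
regularity (A)/(B), NE2, (CONV-C) as a whole, `BetaPertH`, continuum, Clay.  «not in print; our proof attempt».  HONEST DEPENDENCY: continuum YM
on T⁴ ⇐ BetaPertH ∧ nine spine estimates (0/9 proved); BetaPertH ⇐ (D1) ∧ (D4) ∧ CAP+tail; G-an2-4 gates asym, D1 and NE2/3/4.
-/

noncomputable section

open scoped BigOperators ComplexConjugate
open Finset Real

namespace Summit.QuantumFields.BalabanUV.Beta.GAN24.DirichletRingWirtinger

/-! ## §1 Weighted AM–GM and the ground state -/

/-- weighted arithmetic–geometric mean for a complex cross term: `2·Re(āb) ≤ (q/p)|a|² + (p/q)|b|²` for `p, q > 0`. [folklore] -/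
theorem two_re_conj_mul_le (a b : ℂ) {p q : ℝ} (hp : 0 < p) (hq : 0 < q) :
    2 * (conj a * b).re ≤ q / p * ‖a‖ ^ 2 + p / q * ‖b‖ ^ 2 := by
  rw [Complex.mul_re, Complex.conj_re, Complex.conj_im, Complex.sq_norm, Complex.sq_norm, Complex.normSq_apply,
    Complex.normSq_apply, div_mul_eq_mul_div, div_mul_eq_mul_div, div_add_div _ _ hp.ne' hq.ne', le_div_iff₀ (mul_pos hp hq)]
  nlinarith [sq_nonneg (q * a.re - p * b.re), sq_nonneg (q * a.im - p * b.im), mul_pos hp hq]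

/-- the ground state is positive inside the path: `0 < sin(π i/m)` for `0 < i < m`. [folklore] -/
theorem sin_ground_pos {m i : ℕ} (hi : 0 < i) (him : i < m) : 0 < Real.sin (π * i / m) := by
  have hmR : (0 : ℝ) < m := by exact_mod_cast lt_of_le_of_lt (Nat.zero_le i) him
  have hiR : (0 : ℝ) < i := by exact_mod_cast hi
  have himR : (i : ℝ) < m := by exact_mod_cast him
  refine Real.sin_pos_of_pos_of_lt_pi (by positivity) ?_
  rw [div_lt_iff₀ hmR]
  nlinarith [Real.pi_pos]

/-- sum-to-product: `sin(x+y) + sin(x−y) = 2cos(y)·sin(x)` — the eigen-relation of the ground state. [folklore] -/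
theorem sin_succ_add_sin_pred (x y : ℝ) : Real.sin (x + y) + Real.sin (x - y) = 2 * Real.cos y * Real.sin x := by
  rw [Real.sin_add, Real.sin_sub]; ring

/-! ## §2 The sharp discrete Wirtinger inequality on a path with Dirichlet ends -/

/-- **THE SHARP DISCRETE WIRTINGER INEQUALITY** (path with `m` edges, zero values at both ends): for `m ≥ 2` and `g 0 = g m = 0`,
`(2 − 2cos(π/m))·Σ_{i<m}‖g i‖² ≤ Σ_{i<m}‖g(i+1) − g i‖²`.  Proof: ground-state substitution — termwise weighted AM–GM with the weights
`sin(π(i+1)/m)/sin(πi/m)`, then the eigen-relation. [folklore] -/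
theorem wirtinger_path {m : ℕ} (hm : 2 ≤ m) (g : ℕ → ℂ) (h0 : g 0 = 0) (hgm : g m = 0) :
    (2 - 2 * Real.cos (π / m)) * ∑ i ∈ range m, ‖g i‖ ^ 2 ≤ ∑ i ∈ range m, ‖g (i + 1) - g i‖ ^ 2 := by
  set v : ℕ → ℝ := fun i => Real.sin (π * i / m) with hv
  have hmR : (0 : ℝ) < m := by exact_mod_cast (by omega : 0 < m)
  have hv0 : v 0 = 0 := by simp [hv]
  have hvm : v m = 0 := by
    simp only [hv]
    rw [mul_div_assoc, div_self hmR.ne', mul_one]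
    exact Real.sin_pi
  have hvpos : ∀ i, 0 < i → i < m → 0 < v i := fun i hi him => sin_ground_pos hi him
  have hrec : ∀ i : ℕ, Real.sin (π * ((i : ℝ) + 1) / m) + Real.sin (π * ((i : ℝ) - 1) / m) = 2 * Real.cos (π / m) * v i := by
    intro i
    have e1 : π * ((i : ℝ) + 1) / m = π * i / m + π / m := by ring
    have e2 : π * ((i : ℝ) - 1) / m = π * i / m - π / m := by ring
    rw [e1, e2, sin_succ_add_sin_pred]
  -- (i) expand the Dirichlet form: `Σ‖g(i+1) − g i‖² = 2S − 2C`
  set S : ℝ := ∑ i ∈ range m, ‖g i‖ ^ 2 with hS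
  set C : ℝ := ∑ i ∈ range m, (conj (g i) * g (i + 1)).re with hC
  have hshift : ∑ i ∈ range m, ‖g (i + 1)‖ ^ 2 = S := by
    have hs := Finset.sum_range_succ' (fun i => ‖g i‖ ^ 2) m
    rw [Finset.sum_range_succ, h0, hgm, norm_zero, zero_pow two_ne_zero, add_zero, add_zero] at hs
    exact hs.symm
  have hexp : ∑ i ∈ range m, ‖g (i + 1) - g i‖ ^ 2 = 2 * S - 2 * C := by
    have hterm : ∀ i, ‖g (i + 1) - g i‖ ^ 2 = ‖g (i + 1)‖ ^ 2 + ‖g i‖ ^ 2 - 2 * (conj (g i) * g (i + 1)).re := by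
      intro i
      rw [Complex.sq_norm, Complex.sq_norm, Complex.sq_norm, Complex.normSq_sub, mul_comm (g (i + 1))]
    simp only [hterm, Finset.sum_sub_distrib, Finset.sum_add_distrib, ← Finset.mul_sum]
    rw [hshift]
    ring
  -- (ii) termwise weighted AM–GM
  have hterm2 : ∀ i ∈ range m, 2 * (conj (g i) * g (i + 1)).re
      ≤ v (i + 1) / v i * ‖g i‖ ^ 2 + v i / v (i + 1) * ‖g (i + 1)‖ ^ 2 := by
    intro i hi
    have him := Finset.mem_range.mp hi
    rcases Nat.eq_zero_or_pos i with rfl | hi0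
    · rw [h0]; simp [hv0]
    · by_cases hlast : i + 1 = m
      · rw [hlast, hgm]; simp [hvm]
      · exact two_re_conj_mul_le (g i) (g (i + 1)) (hvpos i hi0 him) (hvpos (i + 1) (Nat.succ_pos i) (by omega))
  -- (iii) sum, re-index the second family, and use the eigen-relation
  set F : ℕ → ℝ := fun j => Real.sin (π * ((j : ℝ) - 1) / m) / v j * ‖g j‖ ^ 2 with hF
  have hkey : ∀ i : ℕ, v i / v (i + 1) * ‖g (i + 1)‖ ^ 2 = F (i + 1) := by
    intro i
    simp only [hF, hv, Nat.cast_succ, add_sub_cancel_right]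
  have hreindex : ∑ i ∈ range m, v i / v (i + 1) * ‖g (i + 1)‖ ^ 2 = ∑ i ∈ range m, F i := by
    rw [Finset.sum_congr rfl (fun i _ => hkey i)]
    have hs := Finset.sum_range_succ' F m
    rw [Finset.sum_range_succ] at hs
    have hF0 : F 0 = 0 := by simp [hF, h0]
    have hFm : F m = 0 := by simp [hF, hgm]
    linarith
  have hCle : 2 * C ≤ 2 * Real.cos (π / m) * S := by
    calc 2 * C = ∑ i ∈ range m, 2 * (conj (g i) * g (i + 1)).re := by rw [hC, Finset.mul_sum]
      _ ≤ ∑ i ∈ range m, (v (i + 1) / v i * ‖g i‖ ^ 2 + v i / v (i + 1) * ‖g (i + 1)‖ ^ 2) := Finset.sum_le_sum hterm2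
      _ = ∑ i ∈ range m, v (i + 1) / v i * ‖g i‖ ^ 2 + ∑ i ∈ range m, F i := by
          rw [Finset.sum_add_distrib, hreindex]
      _ = ∑ i ∈ range m, (v (i + 1) + Real.sin (π * ((i : ℝ) - 1) / m)) / v i * ‖g i‖ ^ 2 := by
          rw [← Finset.sum_add_distrib]
          refine Finset.sum_congr rfl fun i _ => ?_
          rw [hF, add_div, add_mul]
      _ = ∑ i ∈ range m, 2 * Real.cos (π / m) * ‖g i‖ ^ 2 := by
          refine Finset.sum_congr rfl fun i hi => ?_
          rcases Nat.eq_zero_or_pos i with rfl | hi0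
          · rw [h0, norm_zero, zero_pow two_ne_zero, mul_zero, mul_zero]
          · have hvi : v i ≠ 0 := (hvpos i hi0 (Finset.mem_range.mp hi)).ne'
            have e : v (i + 1) = Real.sin (π * ((i : ℝ) + 1) / m) := by simp only [hv, Nat.cast_succ]
            rw [e, hrec i, mul_div_assoc, div_self hvi, mul_one]
      _ = 2 * Real.cos (π / m) * S := by rw [hS, Finset.mul_sum]
  rw [hexp]
  nlinarith [hCle]

/-! ## §3 The constant: `2 − 2cos(π/m) = 4sin²(π/2m) ≥ (π/m)² − (π/m)⁴/12`, so its inverse is at most `m²/π² + 1/6` -/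

/-- `2 − 2cos(π/m) = 4sin²(π/(2m))`. [folklore] -/
theorem two_sub_two_cos_eq (m : ℝ) : 2 - 2 * Real.cos (π / m) = 4 * Real.sin (π / (2 * m)) ^ 2 := by
  rw [Real.sin_sq_eq_half_sub]
  have e : 2 * (π / (2 * m)) = π / m := by
    rcases eq_or_ne m 0 with h | h
    · simp [h]
    · field_simp
  rw [e]
  ring

/-- `2 − 2cos(π/m) ≥ (π/m)² − (π/m)⁴/12` for `m ≥ 1` (from `sin x ≥ x − x³/6`). [folklore] -/
theorem two_sub_two_cos_ge {m : ℕ} (hm : 1 ≤ m) :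
    (π / m) ^ 2 - (π / m) ^ 4 / 12 ≤ 2 - 2 * Real.cos (π / m) := by
  have hmR : (1 : ℝ) ≤ m := by exact_mod_cast hm
  have hm0 : (0 : ℝ) < m := by linarith
  set x : ℝ := π / (2 * m) with hx
  have hx0 : 0 < x := by rw [hx]; positivity
  have hxle : x ≤ 2 := by
    rw [hx, div_le_iff₀ (by positivity)]
    nlinarith [Real.pi_lt_four]
  have hsin : x - x ^ 3 / 6 ≤ Real.sin x := (Real.sin_gt_sub_cube hx0).le
  have hx2 : x ^ 2 ≤ 4 := by nlinarith
  have hnn : 0 ≤ x - x ^ 3 / 6 := by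
    have h3 : x ^ 3 ≤ 4 * x := by
      rw [show x ^ 3 = x * x ^ 2 by ring]
      nlinarith [mul_le_mul_of_nonneg_left hx2 hx0.le]
    nlinarith
  have hsq : (x - x ^ 3 / 6) ^ 2 ≤ Real.sin x ^ 2 := pow_le_pow_left₀ hnn hsin 2
  have epm : π / m = 2 * x := by rw [hx]; field_simp
  rw [two_sub_two_cos_eq, epm]
  nlinarith [hsq, pow_nonneg hx0.le 6]

/-- **the usable constant**: `(2 − 2cos(π/m))⁻¹ ≤ m²/π² + 1/6` for `m ≥ 2`. [folklore] -/
theorem inv_two_sub_two_cos_le {m : ℕ} (hm : 2 ≤ m) :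
    (2 - 2 * Real.cos (π / m))⁻¹ ≤ (m : ℝ) ^ 2 / π ^ 2 + 1 / 6 := by
  have hmR : (2 : ℝ) ≤ m := by exact_mod_cast hm
  have hm0 : (0 : ℝ) < m := by linarith
  have hπ := Real.pi_pos
  have hπ4 := Real.pi_lt_four
  have hπ3 := Real.pi_gt_three
  have hge := two_sub_two_cos_ge (m := m) (by omega)
  -- `λ ≥ (π/m)²(1 − π²/(12m²)) > 0` and `λ·(m²/π² + 1/6) ≥ 1`
  have hlow : 0 < (π / m) ^ 2 - (π / m) ^ 4 / 12 := by
    have h1 : (π / m) ^ 2 ≤ 4 := by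
      rw [div_pow, div_le_iff₀ (by positivity)]; nlinarith
    have h2 : 0 < (π / m) ^ 2 := by positivity
    nlinarith
  have hpos : 0 < 2 - 2 * Real.cos (π / m) := lt_of_lt_of_le hlow hge
  rw [inv_le_iff_one_le_mul₀ hpos]
  have hB : 0 ≤ (m : ℝ) ^ 2 / π ^ 2 + 1 / 6 := by positivity
  have hprod : 1 ≤ ((π / m) ^ 2 - (π / m) ^ 4 / 12) * ((m : ℝ) ^ 2 / π ^ 2 + 1 / 6) := by
    have e : ((π / m) ^ 2 - (π / m) ^ 4 / 12) * ((m : ℝ) ^ 2 / π ^ 2 + 1 / 6)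
        = 1 + (π ^ 2 / (12 * (m : ℝ) ^ 2)) * (1 - π ^ 2 / (6 * (m : ℝ) ^ 2)) := by
      field_simp
      ring
    rw [e]
    have h3 : π ^ 2 / (6 * (m : ℝ) ^ 2) ≤ 1 := by
      rw [div_le_one (by positivity)]; nlinarith
    have h4 : 0 ≤ π ^ 2 / (12 * (m : ℝ) ^ 2) := by positivity
    nlinarith
  calc (1 : ℝ) ≤ ((π / m) ^ 2 - (π / m) ^ 4 / 12) * ((m : ℝ) ^ 2 / π ^ 2 + 1 / 6) := hprod
    _ = ((m : ℝ) ^ 2 / π ^ 2 + 1 / 6) * ((π / m) ^ 2 - (π / m) ^ 4 / 12) := mul_comm _ _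
    _ ≤ ((m : ℝ) ^ 2 / π ^ 2 + 1 / 6) * (2 - 2 * Real.cos (π / m)) := mul_le_mul_of_nonneg_left hge hB

/-- **THE DISCRETE WIRTINGER INEQUALITY WITH AN EXPLICIT CONSTANT**: for `m ≥ 2` and `g 0 = g m = 0`,
`Σ_{i<m}‖g i‖² ≤ (m²/π² + 1/6)·Σ_{i<m}‖g(i+1) − g i‖²`. [folklore] -/
theorem wirtinger_path_explicit {m : ℕ} (hm : 2 ≤ m) (g : ℕ → ℂ) (h0 : g 0 = 0) (hgm : g m = 0) :
    ∑ i ∈ range m, ‖g i‖ ^ 2 ≤ ((m : ℝ) ^ 2 / π ^ 2 + 1 / 6) * ∑ i ∈ range m, ‖g (i + 1) - g i‖ ^ 2 := by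
  have hw := wirtinger_path hm g h0 hgm
  have hinv := inv_two_sub_two_cos_le hm
  have hge := two_sub_two_cos_ge (m := m) (by omega)
  have hmR : (2 : ℝ) ≤ m := by exact_mod_cast hm
  have hlow : 0 < (π / m) ^ 2 - (π / m) ^ 4 / 12 := by
    have h1 : (π / m) ^ 2 ≤ 4 := by
      rw [div_pow, div_le_iff₀ (by positivity)]; nlinarith [Real.pi_lt_four, Real.pi_pos]
    have h2 : 0 < (π / m) ^ 2 := by positivity
    nlinarith
  have hpos : 0 < 2 - 2 * Real.cos (π / m) := lt_of_lt_of_le hlow hge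
  have hS0 : 0 ≤ ∑ i ∈ range m, ‖g (i + 1) - g i‖ ^ 2 := Finset.sum_nonneg fun _ _ => sq_nonneg _
  calc ∑ i ∈ range m, ‖g i‖ ^ 2 = (2 - 2 * Real.cos (π / m))⁻¹ * ((2 - 2 * Real.cos (π / m)) * ∑ i ∈ range m, ‖g i‖ ^ 2) := by
        rw [← mul_assoc, inv_mul_cancel₀ hpos.ne', one_mul]
    _ ≤ (2 - 2 * Real.cos (π / m))⁻¹ * ∑ i ∈ range m, ‖g (i + 1) - g i‖ ^ 2 :=
        mul_le_mul_of_nonneg_left hw (inv_pos.mpr hpos).le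
    _ ≤ ((m : ℝ) ^ 2 / π ^ 2 + 1 / 6) * ∑ i ∈ range m, ‖g (i + 1) - g i‖ ^ 2 := mul_le_mul_of_nonneg_right hinv hS0

end Summit.QuantumFields.BalabanUV.Beta.GAN24.DirichletRingWirtinger

end
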